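import Summits.AtomisticToContinuum.Crystallization.Theorems.SquareWellLayerCakeGapTwelveToBarlowCombinatorialLayeringTransportSteps1
import Summits.AtomisticToContinuum.Crystallization.Theorems.SquareWellLayerCakeGapTwelveToBarlowCombinatorialLayeringTransportSteps2
import Summits.AtomisticToContinuum.Crystallization.Theorems.SquareWellLayerCakeGapTwelveToBarlowCombinatorialLayeringTransportSteps3
import Summits.AtomisticToContinuum.Crystallization.Theorems.SquareWellLayerCakeGapTwelveToBarlowCombinatorialLayeringTransportSteps4

/-!
# Combinatorial layering (B1a of `GapTwelveToBarlow`): transport port, part `Steps5`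

Crux `SquareWellLayerCake.GapTwelveToBarlow` (stmt-AtomisticToContinuum-15807), line `Sketch`,
stub `stub_combinatorialLayering`, residual `(H_develop)`.  PORT of the tree file
`PalmUnimodularRigidityShellsToBarlowChartTransportSteps5.lean` (crux 9227) to graded combinatorial
charts (port rules: `…CombinatorialLayeringTransportSteps1`): `JinvStep_spec` (mirror image of
`IinvStep_spec`), `capWithAny_of_mem_cap`, and the inverse identities `I⁻¹ ∘ I = id`,
`I ∘ I⁻¹ = id`, `J⁻¹ ∘ J = id` on valid frames in the admissible regimes.  All `[folklore]`.
-/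

noncomputable section

namespace Summit.AtomisticToContinuum.Crystallization.Theorems.SquareWellLayerCakeGapTwelveToBarlow

open Literature.Geometry.DiscreteGeometry Literature.MathematicalPhysics.StatisticalMechanics
open Summit.AtomisticToContinuum.Crystallization.Theorems.PalmUnimodularRigidityShellsToBarlowChart hiding
  IsZChart TransportSystem scales_tied sqNormInt_transfer bond_symm nb_mem zlab_spec zlab_nb
  bond_nb_iff pattern_cases transfer_nb_nb transfer_nb_centre transfer_nb_target
  sqNormInt_zlab_centre hcp_of_mirror_pair Istep_spec Jstep_spec IinvStep_spec JinvStep_spec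
  capWithAny_of_mem_cap IinvStep_Istep Istep_IinvStep JinvStep_Jstep Jstep_JinvStep polar_at_apex
  onesided_at_apex Vstep_spec nb_inj Istep_lower Jstep_lower IinvStep_lower JinvStep_lower
  polar_at_lower_apex onesided_at_lower_apex VinvStep_spec attach_I_even attach_I_odd
  attach_lower_I_pos attach_lower_I_neg attach_J_even attach_J_odd Vstep_Istep_pt Vstep_Istep_back
  Vstep_Istep_side Vstep_Jstep_pt Vstep_Istep_comm Vstep_Jstep_comm attach_lower_J_pos
  attach_lower_J_neg VinvStep_Istep_pt VinvStep_Jstep_pt VinvStep_Istep_back VinvStep_Istep_side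
  VinvStep_Istep_comm VinvStep_Jstep_comm Istep_Jstep_comm

variable {S : ℕ → Set (EuclideanSpace ℝ (Fin 3))}
  {B : EuclideanSpace ℝ (Fin 3) → EuclideanSpace ℝ (Fin 3) → Prop}
  {Pc : EuclideanSpace ℝ (Fin 3) → Finset (Fin 3 → ℤ)}
  {nb : EuclideanSpace ℝ (Fin 3) → (Fin 3 → ℤ) → EuclideanSpace ℝ (Fin 3)}

variable
  (hch : (∀ n : ℕ, ∀ z ∈ S n, (Pc z = fcc3Int ∨ Pc z = hcpInt) ∧
      Set.BijOn (nb z) (↑(Pc z) : Set (Fin 3 → ℤ)) {y | B z y} ∧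
      ∀ t ∈ Pc z, ∀ t' ∈ Pc z, (B (nb z t) (nb z t') ↔ sqNormInt (t - t') = 18)) ∧
    (∀ n : ℕ, ∀ z ∈ S (n + 1), ∀ y, B z y → y ∈ S n) ∧
    (∀ n m : ℕ, ∀ x ∈ S n, ∀ y ∈ S m, B x y →
      ∀ (z z' : EuclideanSpace ℝ (Fin 3)) (t t' u u' : Fin 3 → ℤ),
        (t = 0 ∧ z = x ∨ t ∈ Pc x ∧ z = nb x t) → (t' = 0 ∧ z' = x ∨ t' ∈ Pc x ∧ z' = nb x t') →
        (u = 0 ∧ z = y ∨ u ∈ Pc y ∧ z = nb y u) → (u' = 0 ∧ z' = y ∨ u' ∈ Pc y ∧ z' = nb y u') →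
        sqNormInt (u - u') = sqNormInt (t - t')) ∧
    (∀ x y, B x y → B y x))

include hch

/-- **The J⁻¹-step.**  For a valid frame `⟨x, t₁, t₂, U⟩` in the admissible regime, `JinvStep`
lands at the bonded site `y = nb x (−t₂)`, produces a valid frame of the same parity, the type
propagates, and the labels at `y` of `x`, `nb x (t₁ − t₂)`, `nb x (−t₁)` are `w`, `v`, `w − v`
with `−w, −v` labels; the new upper cap is the cap of the label `μ` of the transported
reference `nb x cm`, `cm` the unique `U`-element touching `−t₂`, and `μ` is its unique element
touching `w`. [folklore] -/
theorem JinvStep_spec {n : ℕ} {x : (EuclideanSpace ℝ (Fin 3))} (hx : x ∈ S (n + 1)) {t₁ t₂ : Fin 3 → ℤ} {U : Finset (Fin 3 → ℤ)} (hU : IsFrame (Pc x) t₁ t₂ U) (hreg : Pc (nb x (-t₂)) = fcc3Int ∨ Pc x = hcpInt ∨ (-zlab Pc nb (nb x (-t₂)) x ∈ Pc (nb x (-t₂)) ∧ -zlab Pc nb (nb x (-t₂)) (nb x (t₁ - t₂)) ∈ Pc (nb x (-t₂)))) : nb x (-t₂) ∈ S n ∧ (B x (nb x (-t₂))) ∧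 zlab Pc nb (nb x (-t₂)) x ∈ Pc (nb x (-t₂)) ∧ nb (nb x (-t₂)) (zlab Pc nb (nb x (-t₂)) x) = x ∧ zlab Pc nb (nb x (-t₂)) (nb x (t₁ - t₂)) ∈ Pc (nb x (-t₂)) ∧ nb (nb x (-t₂)) (zlab Pc nb (nb x (-t₂)) (nb x (t₁ - t₂))) = nb x (t₁ - t₂) ∧ -zlab Pc nb (nb x (-t₂)) x ∈ Pc (nb x (-t₂)) ∧ -zlab Pc nb (nb x (-t₂)) (nb x (t₁ - t₂)) ∈ Pc (nb x (-t₂)) ∧ sqNormInt (zlab Pc nb (nb x (-t₂)) x - zlab Pc nb (nb x (-t₂)) (nb x (t₁ - t₂))) = 18 ∧ zlab Pc nb (nb x (-t₂)) (nb x (-t₁)) = zlab Pc nb (nb x (-t₂)) x - zlab Pc nb (nb x (-t₂)) (nb x (t₁ - t₂)) ∧ (Pc x = hcpInt → Pc (nb x (-t₂)) = hcpInt) ∧ IsFrame (Pc (nb x (-t₂))) (JinvStep Pc nb ⟨x, t₁, t₂, U⟩).t₁ (JinvStep Pc nb ⟨x, t₁, t₂, U⟩).t₂ (JinvStep Pc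 nb ⟨x, t₁, t₂, U⟩).U ∧ frameParity (JinvStep Pc nb ⟨x, t₁, t₂, U⟩).t₁ (JinvStep Pc nb ⟨x, t₁, t₂, U⟩).t₂ (JinvStep Pc nb ⟨x, t₁, t₂, U⟩).U = frameParity t₁ t₂ U ∧ ∃ cm ∈ U, sqNormInt (cm + t₂) = 18 ∧ U.filter (fun e => sqNormInt (e + t₂) = 18) = {cm} ∧ (B (nb x (-t₂)) (nb x cm)) ∧ zlab Pc nb (nb x (-t₂)) (nb x cm) ∈ (JinvStep Pc nb ⟨x, t₁, t₂, U⟩).U ∧ (JinvStep Pc nb ⟨x, t₁, t₂, U⟩).U = capWithAny (Pc (nb x (-t₂))) (JinvStep Pc nb ⟨x, t₁, t₂, U⟩).t₁ (JinvStep Pc nb ⟨x, t₁, t₂, U⟩).t₂ {zlab Pc nb (nb x (-t₂)) (nb x cm)} ∧ (JinvStep Pc nb ⟨x, t₁, t₂, U⟩).U.filter (fun e => sqNormInt (e - (JinvStep Pc nb ⟨x, t₁, t₂, U⟩).t₂) = 18) = {zlab Pc nb (nb x (-t₂)) (nb x cm)} := by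
  obtain ⟨h12, hhex, hUP, hoff, c, hcU, hform⟩ := hU
  have hPx := pattern_cases hch hx
  have ht₁ : t₁ ∈ Pc x := hhex (mem_hexLabels_iff.2 (Or.inl rfl))
  have ht₂ : t₂ ∈ Pc x := hhex (mem_hexLabels_iff.2 (Or.inr (Or.inl rfl)))
  have ht12 : t₁ - t₂ ∈ Pc x := hhex (mem_hexLabels_iff.2 (Or.inr (Or.inr (Or.inr (Or.inr (Or.inr rfl))))))
  have hnt₁ : -t₁ ∈ Pc x := hhex (mem_hexLabels_iff.2 (Or.inr (Or.inr (Or.inr (Or.inl rfl)))))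
  have hnt₂ : -t₂ ∈ Pc x := hhex (mem_hexLabels_iff.2 (Or.inr (Or.inr (Or.inr (Or.inr (Or.inl rfl))))))
  have hcP : c ∈ Pc x := hUP hcU
  have hc : c ∉ hexLabels t₁ t₂ := hoff c hcU
  have hhx := dist_hexagon (Pc x) hPx t₁ ht₁ t₂ ht₂ h12 hhex
  -- the new site
  have hy := nb_mem hch hx hnt₂
  have hPy := pattern_cases hch hy.1
  -- bonds from `y` to `K = nb x (t₁ - t₂)` and `I⁻ = nb x (-t₁)`
  have hbK : B (nb x (-t₂)) (nb x (t₁ - t₂)) :=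
    (bond_nb_iff hch hx hnt₂ ht12).2 hhx.2.2.2.2.2.2.2.2.2.2.2
  have hbJ : B (nb x (-t₂)) (nb x (-t₁)) :=
    (bond_nb_iff hch hx hnt₂ hnt₁).2 (by
      rw [show -t₂ - -t₁ = t₁ - t₂ by abel]; exact h12)
  -- labels at `y`
  have hw := zlab_spec hch hy.1 hx (bond_symm hch hy.2)
  have hv := zlab_spec hch hy.1 (nb_mem hch hx ht12).1 hbK
  have hθ := zlab_spec hch hy.1 (nb_mem hch hx hnt₁).1 hbJ
  set w := zlab Pc nb (nb x (-t₂)) x with hw_def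
  set v := zlab Pc nb (nb x (-t₂)) (nb x (t₁ - t₂)) with hv_def
  set θ := zlab Pc nb (nb x (-t₂)) (nb x (-t₁)) with hθ_def
  -- transfers among `x, K, I⁻`
  have Dvw : sqNormInt (v - w) = 18 := by
    rw [hv_def, hw_def, transfer_nb_centre hch hx hy.1 hy.2 ht12 hbK]; exact h12
  have Dwv : sqNormInt (w - v) = 18 := by rw [sqNormInt_sub_comm]; exact Dvw
  have Dθw : sqNormInt (θ - w) = 18 := by
    rw [hθ_def, hw_def, transfer_nb_centre hch hx hy.1 hy.2 hnt₁ hbJ, sqNormInt_neg]; exact hhx.1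
  have Dθv : sqNormInt (θ - v) = 54 := by
    rw [hθ_def, hv_def, transfer_nb_nb hch hx hy.1 hy.2 hnt₁ ht12 hbJ hbK,
      show -t₁ - (t₁ - t₂) = -(2 • t₁ - t₂) by abel, sqNormInt_neg]
    exact hhx.2.2.2.1
  rcases hform with hE | hO
  · /- EVEN source cap: reference `cm = c - t₂` -/
    have hc1 : c - t₁ ∈ Pc x := hUP (by rw [hE]; simp)
    have hc2 : c - t₂ ∈ Pc x := hUP (by rw [hE]; simp)
    have hdx := dist_evenCap (Pc x) hPx t₁ ht₁ t₂ ht₂ c hcP h12 hhex hc hc1 hc2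
    have hbu : B (nb x (-t₂)) (nb x (c - t₂)) :=
      (bond_nb_iff hch hx hnt₂ hc2).2 hdx.2.2.2.2.2.2.2.1
    have hμ := zlab_spec hch hy.1 (nb_mem hch hx hc2).1 hbu
    set μ := zlab Pc nb (nb x (-t₂)) (nb x (c - t₂)) with hμ_def
    have Dμw : sqNormInt (μ - w) = 18 := by
      rw [hμ_def, hw_def, transfer_nb_centre hch hx hy.1 hy.2 hc2 hbu]
      exact chart_sqNormInt_eq hch hx hc2
    have Dwμ : sqNormInt (w - μ) = 18 := by rw [sqNormInt_sub_comm]; exact Dμw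
    have Dvμ : sqNormInt (v - μ) = 18 := by
      rw [hv_def, hμ_def, transfer_nb_nb hch hx hy.1 hy.2 ht12 hc2 hbK hbu]
      exact hdx.2.2.2.2.2.2.2.2.2.1
    have hsym : -w ∈ Pc (nb x (-t₂)) ∧ -v ∈ Pc (nb x (-t₂)) ∧
        (Pc x = hcpInt → Pc (nb x (-t₂)) = hcpInt) := by
      by_cases hxh : Pc x = hcpInt
      · have hfr : ∀ q, q ∈ hcpInt ↔ q ∈ Pc x := fun q => by rw [hxh]
        obtain ⟨d, hd, h48, hd1, hd2, hdoff, hL⟩ := lowerCap_evenCap_hcp t₁ ((hfr _).2 ht₁) t₂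
          ((hfr _).2 ht₂) c ((hfr _).2 hcP) h12 (by rw [hxh] at hhex; exact hhex) hc
          ((hfr _).2 hc1) ((hfr _).2 hc2)
        have hdP : d ∈ Pc x := (hfr d).1 (mem_lowerCap_iff.1 hd).1
        have hd2P : d - t₂ ∈ Pc x := (hfr _).1 hd2
        have hdx' := dist_evenCap (Pc x) hPx t₁ ht₁ t₂ ht₂ d hdP h12 hhex hdoff ((hfr _).1 hd1) hd2P
        have h48' : sqNormInt (c - t₂ - (d - t₂)) = 48 := by
          rw [show c - t₂ - (d - t₂) = c - d by abel]; exact h48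
        have hbl : B (nb x (-t₂)) (nb x (d - t₂)) :=
          (bond_nb_iff hch hx hnt₂ hd2P).2 hdx'.2.2.2.2.2.2.2.1
        obtain ⟨hPy', heq⟩ := hcp_of_mirror_pair hch hx hnt₂ hc2 hd2P h48' hbu hbl
        have hlam := zlab_spec hch hy.1 (nb_mem hch hx hd2P).1 hbl
        have Dwlam : sqNormInt (w - zlab Pc nb (nb x (-t₂)) (nb x (d - t₂))) = 18 := by
          rw [sqNormInt_sub_comm, hw_def, transfer_nb_centre hch hx hy.1 hy.2 hd2P hbl]
          exact chart_sqNormInt_eq hch hx hd2P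
        have Dvlam : sqNormInt (v - zlab Pc nb (nb x (-t₂)) (nb x (d - t₂))) = 18 := by
          rw [hv_def, transfer_nb_nb hch hx hy.1 hy.2 ht12 hd2P hbK hbl]
          exact hdx'.2.2.2.2.2.2.2.2.2.1
        exact ⟨heq w hw.1 Dwμ Dwlam, heq v hv.1 Dvμ Dvlam, fun _ => hPy'⟩
      · have hS : -w ∈ Pc (nb x (-t₂)) ∧ -v ∈ Pc (nb x (-t₂)) := by
          rcases hreg with hA | hB | hS
          · constructor
            · rw [hA] at hw ⊢; exact neg_mem_fcc3Int w hw.1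
            · rw [hA] at hv ⊢; exact neg_mem_fcc3Int v hv.1
          · exact (hxh hB).elim
          · exact hS
        exact ⟨hS.1, hS.2, fun h => (hxh h).elim⟩
    obtain ⟨hnw, hnv, htype⟩ := hsym
    have hhexwv : hexLabels w v ⊆ Pc (nb x (-t₂)) :=
      hexLabels_subset_of_symm (Pc (nb x (-t₂))) hPy w hw.1 v hv.1 Dwv hnw hnv
    have hwv : w - v ∈ Pc (nb x (-t₂)) :=
      hhexwv (mem_hexLabels_iff.2 (Or.inr (Or.inr (Or.inr (Or.inr (Or.inr rfl))))))
    have hθeq : θ = w - v :=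
      label_third_vertex (Pc (nb x (-t₂))) hPy v hv.1 w hw.1 θ hθ.1 Dvw Dθw Dθv hwv
    obtain ⟨hframe, hpar, hcap⟩ :=
      apex_Jinv_even (Pc (nb x (-t₂))) hPy w hw.1 v hv.1 μ hμ.1 hnw hnv Dwv Dwμ Dvμ
    have hfilt : U.filter (fun e => sqNormInt (e + t₂) = 18) = {c - t₂} := by
      rw [hE]; exact (filter_evenCap (Pc x) hPx t₁ ht₁ t₂ ht₂ c hcP h12 hhex hc hc1 hc2).2.2.2
    have hI : JinvStep Pc nb ⟨x, t₁, t₂, U⟩ =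
        ⟨nb x (-t₂), v, w, ({μ, μ - v, μ - w} : Finset (Fin 3 → ℤ))⟩ := by
      have h1 : JinvStep Pc nb ⟨x, t₁, t₂, U⟩ =
          ⟨nb x (-t₂), v, w, capWithAny (Pc (nb x (-t₂))) v w {μ}⟩ := by
        simp only [JinvStep, hfilt, Finset.image_singleton]
        try rfl
      rw [h1, hcap]
    have hparx : frameParity t₁ t₂ U = 1 := by
      rw [hE]; exact (isFrame_evenCap (Pc x) hPx t₁ ht₁ t₂ ht₂ c hcP h12 hhex hc hc1 hc2).2
    have hhexvw : hexLabels v w ⊆ Pc (nb x (-t₂)) :=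
      hexLabels_subset_of_symm (Pc (nb x (-t₂))) hPy v hv.1 w hw.1 Dvw hnv hnw
    have hfilt' : ({μ, μ - v, μ - w} : Finset (Fin 3 → ℤ)).filter (fun e => sqNormInt (e - w) = 18) = {μ} := by
      obtain ⟨-, -, hUP', hoff', _⟩ := hframe
      exact (filter_evenCap (Pc (nb x (-t₂))) hPy v hv.1 w hw.1 μ hμ.1 Dvw hhexvw
        (hoff' μ (by simp)) (hUP' (by simp)) (hUP' (by simp))).2.1
    refine ⟨hy.1, hy.2, hw.1, hw.2, hv.1, hv.2, hnw, hnv, Dwv, hθeq, htype, ?_, ?_, c - t₂,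
      (by rw [hE]; simp), (by rw [sub_add_cancel]; exact chart_sqNormInt_eq hch hx hcP), hfilt, hbu,
      ?_, ?_, ?_⟩
    · rw [hI]; exact hframe
    · rw [hI, hparx]; exact hpar
    · rw [hI]; show μ ∈ _; simp
    · rw [hI]; exact hcap.symm
    · rw [hI]; exact hfilt'
  · /- ODD source cap: reference `cm = c` -/
    have hc1 : c + t₁ ∈ Pc x := hUP (by rw [hO]; simp)
    have hc2 : c + t₂ ∈ Pc x := hUP (by rw [hO]; simp)
    have hdx := dist_oddCap (Pc x) hPx t₁ ht₁ t₂ ht₂ c hcP h12 hhex hc hc1 hc2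
    have hbu : B (nb x (-t₂)) (nb x c) :=
      (bond_nb_iff hch hx hnt₂ hcP).2 hdx.2.1
    have hμ := zlab_spec hch hy.1 (nb_mem hch hx hcP).1 hbu
    set μ := zlab Pc nb (nb x (-t₂)) (nb x c) with hμ_def
    have Dμw : sqNormInt (μ - w) = 18 := by
      rw [hμ_def, hw_def, transfer_nb_centre hch hx hy.1 hy.2 hcP hbu]
      exact chart_sqNormInt_eq hch hx hcP
    have Dwμ : sqNormInt (w - μ) = 18 := by rw [sqNormInt_sub_comm]; exact Dμw
    have Dθμ : sqNormInt (θ - μ) = 18 := by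
      rw [hθ_def, hμ_def, transfer_nb_nb hch hx hy.1 hy.2 hnt₁ hcP hbJ hbu]; exact hdx.1
    have Dvμ : sqNormInt (v - μ) = 36 := by
      rw [hv_def, hμ_def, transfer_nb_nb hch hx hy.1 hy.2 ht12 hcP hbK hbu,
        show t₁ - t₂ - c = t₁ - (c + t₂) by abel]
      exact hdx.2.2.2.2.2.1
    have hsym : -w ∈ Pc (nb x (-t₂)) ∧ -v ∈ Pc (nb x (-t₂)) ∧
        (Pc x = hcpInt → Pc (nb x (-t₂)) = hcpInt) := by
      by_cases hxh : Pc x = hcpInt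
      · have hfr : ∀ q, q ∈ hcpInt ↔ q ∈ Pc x := fun q => by rw [hxh]
        obtain ⟨d, hd, h48, hd1, hd2, hdoff, hL⟩ := lowerCap_oddCap_hcp t₁ ((hfr _).2 ht₁) t₂
          ((hfr _).2 ht₂) c ((hfr _).2 hcP) h12 (by rw [hxh] at hhex; exact hhex) hc
          ((hfr _).2 hc1) ((hfr _).2 hc2)
        have hdP : d ∈ Pc x := (hfr d).1 (mem_lowerCap_iff.1 hd).1
        have hdx' := dist_oddCap (Pc x) hPx t₁ ht₁ t₂ ht₂ d hdP h12 hhex hdoff ((hfr _).1 hd1)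
          ((hfr _).1 hd2)
        have hbl : B (nb x (-t₂)) (nb x d) :=
          (bond_nb_iff hch hx hnt₂ hdP).2 hdx'.2.1
        obtain ⟨hPy', heq⟩ := hcp_of_mirror_pair hch hx hnt₂ hcP hdP h48 hbu hbl
        have hlam := zlab_spec hch hy.1 (nb_mem hch hx hdP).1 hbl
        have Dwlam : sqNormInt (w - zlab Pc nb (nb x (-t₂)) (nb x d)) = 18 := by
          rw [sqNormInt_sub_comm, hw_def, transfer_nb_centre hch hx hy.1 hy.2 hdP hbl]
          exact chart_sqNormInt_eq hch hx hdP
        have Dθlam : sqNormInt (θ - zlab Pc nb (nb x (-t₂)) (nb x d)) = 18 := by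
          rw [hθ_def, transfer_nb_nb hch hx hy.1 hy.2 hnt₁ hdP hbJ hbl]; exact hdx'.1
        have hnw : -w ∈ Pc (nb x (-t₂)) := heq w hw.1 Dwμ Dwlam
        have hnθ : -θ ∈ Pc (nb x (-t₂)) := heq θ hθ.1 Dθμ Dθlam
        have hnv : -v ∈ Pc (nb x (-t₂)) := by
          have hwP := hw.1; have hθP := hθ.1; have hvP := hv.1
          rw [hPy'] at hwP hθP hvP hnw hnθ ⊢
          exact neg_mem_of_chain w hwP θ hθP v hvP hnw hnθ Dwv
            (by rw [sqNormInt_sub_comm]; exact Dθw) (by rw [sqNormInt_sub_comm]; exact Dθv)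
        exact ⟨hnw, hnv, fun _ => hPy'⟩
      · have hS : -w ∈ Pc (nb x (-t₂)) ∧ -v ∈ Pc (nb x (-t₂)) := by
          rcases hreg with hA | hB | hS
          · constructor
            · rw [hA] at hw ⊢; exact neg_mem_fcc3Int w hw.1
            · rw [hA] at hv ⊢; exact neg_mem_fcc3Int v hv.1
          · exact (hxh hB).elim
          · exact hS
        exact ⟨hS.1, hS.2, fun h => (hxh h).elim⟩
    obtain ⟨hnw, hnv, htype⟩ := hsym
    have hhexwv : hexLabels w v ⊆ Pc (nb x (-t₂)) :=
      hexLabels_subset_of_symm (Pc (nb x (-t₂))) hPy w hw.1 v hv.1 Dwv hnw hnv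
    have hwv : w - v ∈ Pc (nb x (-t₂)) :=
      hhexwv (mem_hexLabels_iff.2 (Or.inr (Or.inr (Or.inr (Or.inr (Or.inr rfl))))))
    have hθeq : θ = w - v :=
      label_third_vertex (Pc (nb x (-t₂))) hPy v hv.1 w hw.1 θ hθ.1 Dvw Dθw Dθv hwv
    have Dwvμ : sqNormInt (w - v - μ) = 18 := by rw [← hθeq]; exact Dθμ
    obtain ⟨hframe, hpar, hcap⟩ :=
      apex_Jinv_odd (Pc (nb x (-t₂))) hPy w hw.1 v hv.1 μ hμ.1 hnw hnv Dwv Dwμ Dwvμ Dvμ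
    have hfilt : U.filter (fun e => sqNormInt (e + t₂) = 18) = {c} := by
      rw [hO]; exact (filter_oddCap (Pc x) hPx t₁ ht₁ t₂ ht₂ c hcP h12 hhex hc hc1 hc2).2.2.2
    have hI : JinvStep Pc nb ⟨x, t₁, t₂, U⟩ =
        ⟨nb x (-t₂), v, w, ({μ - w, μ - w + v, μ} : Finset (Fin 3 → ℤ))⟩ := by
      have h1 : JinvStep Pc nb ⟨x, t₁, t₂, U⟩ =
          ⟨nb x (-t₂), v, w, capWithAny (Pc (nb x (-t₂))) v w {μ}⟩ := by
        simp only [JinvStep, hfilt, Finset.image_singleton]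
        try rfl
      rw [h1, hcap]
    have hparx : frameParity t₁ t₂ U = -1 := by
      rw [hO]; exact (isFrame_oddCap (Pc x) hPx t₁ ht₁ t₂ ht₂ c hcP h12 hhex hc hc1 hc2).2
    have hhexvw : hexLabels v w ⊆ Pc (nb x (-t₂)) :=
      hexLabels_subset_of_symm (Pc (nb x (-t₂))) hPy v hv.1 w hw.1 Dvw hnv hnw
    have hfilt' : ({μ - w, μ - w + v, μ} : Finset (Fin 3 → ℤ)).filter (fun e => sqNormInt (e - w) = 18) = {μ} := by
      obtain ⟨-, -, hUP', hoff', _⟩ := hframe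
      have := (filter_oddCap (Pc (nb x (-t₂))) hPy v hv.1 w hw.1 (μ - w) (hUP' (by simp)) Dvw hhexvw
        (hoff' (μ - w) (by simp)) (hUP' (by simp)) (by rw [sub_add_cancel]; exact hμ.1)).2.1
      rw [show μ - w + w = μ by abel] at this
      exact this
    have hct : sqNormInt (c + t₂) = 18 := by
      have h0 := hdx.2.1
      rw [show -t₂ - c = -(c + t₂) by abel, sqNormInt_neg] at h0
      exact h0
    refine ⟨hy.1, hy.2, hw.1, hw.2, hv.1, hv.2, hnw, hnv, Dwv, hθeq, htype, ?_, ?_, c,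
      hcU, hct, hfilt, hbu, ?_, ?_, ?_⟩
    · rw [hI]; exact hframe
    · rw [hI, hparx]; exact hpar
    · rw [hI]; show μ ∈ _; simp
    · rw [hI]; exact hcap.symm
    · rw [hI]; exact hfilt'

/-! ## The in-layer steps are mutually inverse -/

/-- For a valid frame, the cap of any of its upper-cap labels is the upper cap. [folklore] -/
theorem capWithAny_of_mem_cap {n : ℕ} {x : (EuclideanSpace ℝ (Fin 3))}
    (hx : x ∈ S n) {t₁ t₂ : Fin 3 → ℤ} {U : Finset (Fin 3 → ℤ)} (hU : IsFrame (Pc x) t₁ t₂ U)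
    {m : Fin 3 → ℤ} (hm : m ∈ U) : capWithAny (Pc x) t₁ t₂ {m} = U := by
  obtain ⟨h12, hhex, hUP, hoff, c, hcU, hform⟩ := hU
  have hPx := pattern_cases hch hx
  have ht₁ : t₁ ∈ Pc x := hhex (mem_hexLabels_iff.2 (Or.inl rfl))
  have ht₂ : t₂ ∈ Pc x := hhex (mem_hexLabels_iff.2 (Or.inr (Or.inl rfl)))
  have hcP : c ∈ Pc x := hUP hcU
  have hc : c ∉ hexLabels t₁ t₂ := hoff c hcU
  have hmP : m ∈ Pc x := hUP hm
  rcases hform with hE | hO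
  · have hc1 : c - t₁ ∈ Pc x := hUP (by rw [hE]; simp)
    have hc2 : c - t₂ ∈ Pc x := hUP (by rw [hE]; simp)
    rw [hE] at hm ⊢
    exact capWithAny_evenCap (Pc x) hPx t₁ ht₁ t₂ ht₂ c hcP m hmP h12 hhex hc hc1 hc2 hm
  · have hc1 : c + t₁ ∈ Pc x := hUP (by rw [hO]; simp)
    have hc2 : c + t₂ ∈ Pc x := hUP (by rw [hO]; simp)
    rw [hO] at hm ⊢
    exact capWithAny_oddCap (Pc x) hPx t₁ ht₁ t₂ ht₂ c hcP m hmP h12 hhex hc hc1 hc2 hm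

/-- **`I⁻¹ ∘ I = id`** on valid frames in the admissible regime. [folklore] -/
theorem IinvStep_Istep {n : ℕ} {x : (EuclideanSpace ℝ (Fin 3))} (hx : x ∈ S (n + 1))
    {t₁ t₂ : Fin 3 → ℤ} {U : Finset (Fin 3 → ℤ)} (hU : IsFrame (Pc x) t₁ t₂ U)
    (hreg : Pc (nb x t₁) = fcc3Int ∨ Pc x = hcpInt ∨
      (-zlab Pc nb (nb x t₁) x ∈ Pc (nb x t₁) ∧ -zlab Pc nb (nb x t₁) (nb x t₂) ∈ Pc (nb x t₁))) :
    IinvStep Pc nb (Istep Pc nb ⟨x, t₁, t₂, U⟩) = ⟨x, t₁, t₂, U⟩ := by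
  obtain ⟨hyS, -, -, hwx, -, hvJ, -, -, -, -, -, -, -, c₁, hc₁U, -, -, hbu, -, -, hfilt'⟩ :=
    Istep_spec hch hx hU hreg
  have hUP : U ⊆ Pc x := hU.2.2.1
  have ht₁ : t₁ ∈ Pc x := hU.2.1 (mem_hexLabels_iff.2 (Or.inl rfl))
  have ht₂ : t₂ ∈ Pc x := hU.2.1 (mem_hexLabels_iff.2 (Or.inr (Or.inl rfl)))
  have hμ := zlab_spec hch hyS (nb_mem hch hx (hUP hc₁U)).1 hbu
  set w := zlab Pc nb (nb x t₁) x with hw_def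
  set v := zlab Pc nb (nb x t₁) (nb x t₂) with hv_def
  set μ := zlab Pc nb (nb x t₁) (nb x c₁) with hμ_def
  set U' := (Istep Pc nb ⟨x, t₁, t₂, U⟩).U with hU'_def
  have hI : Istep Pc nb ⟨x, t₁, t₂, U⟩ = ⟨nb x t₁, -w, v - w, U'⟩ := rfl
  have hf : U'.filter (fun e => sqNormInt (e + -w) = 18) = {μ} := hfilt'
  rw [hI]
  simp only [IinvStep]
  rw [neg_neg, show v - w - -w = v by abel, hwx]
  rw [hf, Finset.image_singleton, hvJ, hμ.2, zlab_nb hch hx ht₁, zlab_nb hch hx ht₂,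
    zlab_nb hch hx (hUP hc₁U), capWithAny_of_mem_cap hch hx hU hc₁U]

/-- **`I ∘ I⁻¹ = id`** on valid frames in the admissible regime. [folklore] -/
theorem Istep_IinvStep {n : ℕ} {x : (EuclideanSpace ℝ (Fin 3))} (hx : x ∈ S (n + 1))
    {t₁ t₂ : Fin 3 → ℤ} {U : Finset (Fin 3 → ℤ)} (hU : IsFrame (Pc x) t₁ t₂ U)
    (hreg : Pc (nb x (-t₁)) = fcc3Int ∨ Pc x = hcpInt ∨
      (-zlab Pc nb (nb x (-t₁)) x ∈ Pc (nb x (-t₁)) ∧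
        -zlab Pc nb (nb x (-t₁)) (nb x (t₂ - t₁)) ∈ Pc (nb x (-t₁)))) :
    Istep Pc nb (IinvStep Pc nb ⟨x, t₁, t₂, U⟩) = ⟨x, t₁, t₂, U⟩ := by
  obtain ⟨hyS, -, -, hwx, -, hvK, -, -, -, -, -, -, -, cm, hcmU, -, -, hbu, -, -, hfilt'⟩ :=
    IinvStep_spec hch hx hU hreg
  have hUP : U ⊆ Pc x := hU.2.2.1
  have hnt₁ : -t₁ ∈ Pc x := hU.2.1 (mem_hexLabels_iff.2 (Or.inr (Or.inr (Or.inr (Or.inl rfl)))))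
  have ht21 : t₂ - t₁ ∈ Pc x := hU.2.1 (mem_hexLabels_iff.2 (Or.inr (Or.inr (Or.inl rfl))))
  have hμ := zlab_spec hch hyS (nb_mem hch hx (hUP hcmU)).1 hbu
  set w := zlab Pc nb (nb x (-t₁)) x with hw_def
  set v := zlab Pc nb (nb x (-t₁)) (nb x (t₂ - t₁)) with hv_def
  set μ := zlab Pc nb (nb x (-t₁)) (nb x cm) with hμ_def
  set U' := (IinvStep Pc nb ⟨x, t₁, t₂, U⟩).U with hU'_def
  have hI : IinvStep Pc nb ⟨x, t₁, t₂, U⟩ = ⟨nb x (-t₁), w, v, U'⟩ := rfl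
  have hf : U'.filter (fun e => sqNormInt (e - w) = 18) = {μ} := hfilt'
  rw [hI]
  simp only [Istep]
  rw [hwx]
  rw [hf, Finset.image_singleton, hvK, hμ.2, zlab_nb hch hx hnt₁, zlab_nb hch hx ht21,
    zlab_nb hch hx (hUP hcmU), neg_neg, show t₂ - t₁ - -t₁ = t₂ by abel,
    capWithAny_of_mem_cap hch hx hU hcmU]

/-- **`J⁻¹ ∘ J = id`** on valid frames in the admissible regime. [folklore] -/
theorem JinvStep_Jstep {n : ℕ} {x : (EuclideanSpace ℝ (Fin 3))} (hx : x ∈ S (n + 1))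
    {t₁ t₂ : Fin 3 → ℤ} {U : Finset (Fin 3 → ℤ)} (hU : IsFrame (Pc x) t₁ t₂ U)
    (hreg : Pc (nb x t₂) = fcc3Int ∨ Pc x = hcpInt ∨
      (-zlab Pc nb (nb x t₂) x ∈ Pc (nb x t₂) ∧ -zlab Pc nb (nb x t₂) (nb x t₁) ∈ Pc (nb x t₂))) :
    JinvStep Pc nb (Jstep Pc nb ⟨x, t₁, t₂, U⟩) = ⟨x, t₁, t₂, U⟩ := by
  obtain ⟨hyS, -, -, hwx, -, hvI, -, -, -, -, -, -, -, c₂, hc₂U, -, -, hbu, -, -, hfilt'⟩ :=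
    Jstep_spec hch hx hU hreg
  have hUP : U ⊆ Pc x := hU.2.2.1
  have ht₁ : t₁ ∈ Pc x := hU.2.1 (mem_hexLabels_iff.2 (Or.inl rfl))
  have ht₂ : t₂ ∈ Pc x := hU.2.1 (mem_hexLabels_iff.2 (Or.inr (Or.inl rfl)))
  have hμ := zlab_spec hch hyS (nb_mem hch hx (hUP hc₂U)).1 hbu
  set w := zlab Pc nb (nb x t₂) x with hw_def
  set v := zlab Pc nb (nb x t₂) (nb x t₁) with hv_def
  set μ := zlab Pc nb (nb x t₂) (nb x c₂) with hμ_def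
  set U' := (Jstep Pc nb ⟨x, t₁, t₂, U⟩).U with hU'_def
  have hI : Jstep Pc nb ⟨x, t₁, t₂, U⟩ = ⟨nb x t₂, v - w, -w, U'⟩ := rfl
  have hf : U'.filter (fun e => sqNormInt (e + -w) = 18) = {μ} := hfilt'
  rw [hI]
  simp only [JinvStep]
  rw [neg_neg, show v - w - -w = v by abel, hwx]
  rw [hf, Finset.image_singleton, hvI, hμ.2, zlab_nb hch hx ht₂, zlab_nb hch hx ht₁,
    zlab_nb hch hx (hUP hc₂U), capWithAny_of_mem_cap hch hx hU hc₂U]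

omit hch in
/-! ## Registered anchor (closed form) -/

omit hch in
/-- **Closed form of `capWithAny_of_mem_cap`** (registered anchor): section data and standing
hypothesis written out, two hypotheses regrouped. [folklore] -/
theorem capWithAny_of_mem_cap_graded :
    ∀ {S : ℕ → Set (EuclideanSpace ℝ (Fin 3))} {B : EuclideanSpace ℝ (Fin 3) → EuclideanSpace ℝ
    (Fin 3) → Prop} {Pc : EuclideanSpace ℝ (Fin 3) → Finset (Fin 3 → ℤ)} {nb : EuclideanSpace ℝ
    (Fin 3) → (Fin 3 → ℤ) → EuclideanSpace ℝ (Fin 3)}, ((∀ n : ℕ, ∀ z ∈ S n, (Pc z =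
    Summit.AtomisticToContinuum.Crystallization.Theorems.PalmUnimodularRigidityShellsToBarlowChart.fcc3Int
    ∨ Pc z = Literature.Geometry.DiscreteGeometry.hcpInt) ∧ Set.BijOn (nb z) (↑(Pc z) : Set (Fin
    3 → ℤ)) {y | B z y} ∧ ∀ t ∈ Pc z, ∀ t' ∈ Pc z, (B (nb z t) (nb z t') ↔
    Literature.Geometry.DiscreteGeometry.sqNormInt (t - t') = 18)) ∧ (∀ n : ℕ, ∀ z ∈ S (n + 1),
    ∀ y, B z y → y ∈ S n) ∧ (∀ n m : ℕ, ∀ x ∈ S n, ∀ y ∈ S m, B x y → ∀ (z z' : EuclideanSpace ℝ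
    (Fin 3)) (t t' u u' : Fin 3 → ℤ), (t = 0 ∧ z = x ∨ t ∈ Pc x ∧ z = nb x t) → (t' = 0 ∧ z' = x
    ∨ t' ∈ Pc x ∧ z' = nb x t') → (u = 0 ∧ z = y ∨ u ∈ Pc y ∧ z = nb y u) → (u' = 0 ∧ z' = y ∨
    u' ∈ Pc y ∧ z' = nb y u') → Literature.Geometry.DiscreteGeometry.sqNormInt (u - u') =
    Literature.Geometry.DiscreteGeometry.sqNormInt (t - t')) ∧ (∀ x y, B x y → B y x)) → ∀ {n :
    ℕ} {x : (EuclideanSpace ℝ (Fin 3))} {t₁ t₂ : Fin 3 → ℤ} {U : Finset (Fin 3 → ℤ)} {m : Fin 3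
    → ℤ},
    Summit.AtomisticToContinuum.Crystallization.Theorems.PalmUnimodularRigidityShellsToBarlowChart.IsFrame
    (Pc x) t₁ t₂ U → x ∈ S n → m ∈ U →
    Summit.AtomisticToContinuum.Crystallization.Theorems.PalmUnimodularRigidityShellsToBarlowChart.capWithAny
    (Pc x) t₁ t₂ {m} = U := by
  intro S B Pc nb hch n x t₁ t₂ U m hU hx hm
  exact capWithAny_of_mem_cap hch hx hU hm

end Summit.AtomisticToContinuum.Crystallization.Theorems.SquareWellLayerCakeGapTwelveToBarlow

end
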